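import Mathlib
import HarnessLib
import Summits.NavierStokesRegularity.NavierStokesRegularity.Theorems.PoloidalWindowDoorPoloidalWindowRigidityEnstrophyHotSpot

/-!
# Route `PoloidalWindowDoor`, crux `PoloidalWindowRigidity` (K2, stmt-NavierStokesRegularity-19708) —
# FIRST-ORDER CONDITIONS AT THE ENSTROPHY HOT SPOT and the poloidal normal form (CENSUS-K2G §16.2, kernel-grade)

Cell ns-regularity-ideate, seat nsreg-p7 gen 5 (third worker under the K2 lead; file landed
`--supports stmt-NavierStokesRegularity-19708`).  Companion of `…EnstrophyHotSpot` (p482100): the vorticity analogue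
of the lead's velocity hot-spot conditions (p472559 `hotSpot_firstOrder`).

* `enstrophyHotSpot_firstOrder` — if `W ∈ 𝔓(C)` has scale-invariant enstrophy `(−t)²|curl W(t,x)|² ≤ M` on the slab
  with equality at `(−1, 0)`, then at the hot spot: `D(|ω|²)(−1,·)(0) = 0`, `Δ(|ω|²)(−1,·)(0) ≤ 0`, and the
  PRODUCTION EXCEEDS THE CRITICAL RATE BY THE DISSIPATION,
  `⟪ω, DW ω⟫(−1,0) ≥ |ω(−1,0)|² + |∇ω(−1,0)|²_F`
  (time-maximality of `t ↦ t²|ω(t,0)|²` gives `∂ₜ|ω|² = 2|ω|²`, space-maximality gives `D|ω|² = 0`, `Δ|ω|² ≤ 0`, and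
  the enstrophy balance `∂ₜ|ω|² + D|ω|²(W) − Δ|ω|² = 2⟪ω, DW ω⟫ − 2|∇ω|²_F` converts them).
* `exists_poloidal_enstrophy_hotSpot` — **NORMAL FORM for the residue S2′**: if some poloidal frozen element of some
  `𝔓(C)` is not irrotational, there is a poloidal frozen `W ∈ 𝔓(C)` whose scale-invariant enstrophy peaks at
  `(−1,0)` with value `M > 0`, where `D|ω|² = 0`, `Δ|ω|² ≤ 0` and `⟪ω, DW ω⟫ ≥ |ω|² + |∇ω|²_F` — for a poloidal field
  the production is the HORIZONTAL-STRAIN form `ω_hᵀ(∇_h W_h)ω_h`, so the horizontal strain along the vortex line at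
  the peak is at least critical plus `|∇ω|²_F/|ω|²` (the residue prover may assume this WLOG, next to the lead's
  velocity hot spot and blow-down recurrence, p469616–p474492).

WHAT THIS IS NOT: not a proof of K2 and nothing about Clay (A) — a normal form (bears_on LADDER-NS N0, route
PoloidalWindowDoor).
-/

noncomputable section

-- the summit and its single sub-problem share the name (CONVENTIONS §1), as in every Theorems file
set_option linter.dupNamespace false

namespace Summit.NavierStokesRegularity.NavierStokesRegularity.Theorems.PoloidalWindowDoorPoloidalWindowRigidityEnstrophyHotSpotFirstOrder

open MeasureTheory Set Function Filter Topology TopologicalSpace Metric InnerProductSpace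
open scoped RealInnerProductSpace InnerProductSpace Laplacian ContDiff
open Literature.Analysis Literature.Analysis.FluidPDE
open Summit.NavierStokesRegularity.NavierStokesRegularity.Theorems
open Summit.NavierStokesRegularity.NavierStokesRegularity.Theorems.LocalSineTubeDoorProfileAlignedWindowRigidityAncient
open Summit.NavierStokesRegularity.NavierStokesRegularity.Theorems.PoloidalWindowDoorPoloidalWindowRigidityWindow
open Summit.NavierStokesRegularity.NavierStokesRegularity.Theorems.PoloidalWindowDoorPoloidalWindowRigidityPoloidalExtremal
open Summit.NavierStokesRegularity.NavierStokesRegularity.Theorems.PoloidalWindowDoorPoloidalWindowRigidityEnstrophyHotSpot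

variable {C : ℝ} {W : ℝ → EuclideanSpace ℝ (Fin 3) → EuclideanSpace ℝ (Fin 3)}

/-! ### First-order conditions at the enstrophy hot spot -/

/-- **FIRST-ORDER CONDITIONS AT THE ENSTROPHY HOT SPOT.**  Let `W ∈ 𝔓(C)` have `(−t)²|curl W(t,x)|² ≤ M` for all
`t < 0`, `x`, with `|curl W(−1,0)|² = M`.  Then at `(−1, 0)`: the gradient of `|ω|²` vanishes, its Laplacian is
nonpositive, and `⟪ω, DW ω⟫ ≥ |ω|² + |∇ω|²_F` (production ≥ critical rate + dissipation). -/
theorem enstrophyHotSpot_firstOrder (hW : IsTypeIAncientMild C W) {M : ℝ}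
    (hle : ∀ t < 0, ∀ x, (-t) ^ 2 * ⟪curl (W t) x, curl (W t) x⟫_ℝ ≤ M)
    (hmax : ⟪curl (W (-1)) 0, curl (W (-1)) 0⟫_ℝ = M) :
    fderiv ℝ (fun y => ⟪curl (W (-1)) y, curl (W (-1)) y⟫_ℝ) 0 = 0 ∧
      (Δ (fun y => ⟪curl (W (-1)) y, curl (W (-1)) y⟫_ℝ)) 0 ≤ 0 ∧
      ⟪curl (W (-1)) 0, curl (W (-1)) 0⟫_ℝ + frobeniusNormSq (fderiv ℝ (curl (W (-1))) 0) ≤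
        ⟪curl (W (-1)) 0, fderiv ℝ (W (-1)) 0 (curl (W (-1)) 0)⟫_ℝ := by
  have hrate : HasTypeITimeDecay C W := hW.hasTypeITimeDecay
  have hcont : ContinuousOn (uncurry W) (Iio (0 : ℝ) ×ˢ univ) := hW.continuousOn_uncurry
  have hmild : ∀ s t : ℝ, s < t → t < 0 → ∀ x,
      W t x = UnboundedOperators.heatExtension (W s) (t - s) x - oseenDuhamel 1 s W W t x :=
    fun s t hst ht x => hW.mild_eq_heatExtension hst ht x
  have hdiv : ∀ t < 0, VectorCalculus.IsDivFree (W t) := fun t ht => hW.isDivFree ht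
  set q : ℝ → EuclideanSpace ℝ (Fin 3) → ℝ := fun τ y => ⟪curl (W τ) y, curl (W τ) y⟫_ℝ with hqdef
  -- the weighted balance with `g(τ) = τ²` at `(−1, 0)`
  have hg : ∀ τ < (0 : ℝ), HasDerivAt (fun τ : ℝ => τ ^ 2) (2 * τ) τ := fun τ _ => by
    simpa using hasDerivAt_pow 2 τ
  obtain ⟨hQd, hid⟩ := weightedEnstrophy_identity hrate hcont hmild hdiv hg (by norm_num : (-1 : ℝ) < 0)
    (0 : EuclideanSpace ℝ (Fin 3))
  -- time-maximality: `τ ↦ τ² q(τ, 0)` has a local maximum at `−1`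
  have htmax : IsLocalMax (fun τ : ℝ => τ ^ 2 * q τ 0) (-1) := by
    filter_upwards [Iio_mem_nhds (by norm_num : (-1 : ℝ) < 0)] with τ hτ
    have h1 := hle τ hτ 0
    rw [neg_sq] at h1
    have h2 : (-1 : ℝ) ^ 2 * q (-1) 0 = M := by
      show (-1 : ℝ) ^ 2 * ⟪curl (W (-1)) 0, curl (W (-1)) 0⟫_ℝ = M
      rw [hmax]; norm_num
    rw [h2]; exact h1
  have hderiv0 : deriv (fun τ : ℝ => τ ^ 2 * ⟪curl (W τ) 0, curl (W τ) 0⟫_ℝ) (-1) = 0 := htmax.deriv_eq_zero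
  -- space-maximality: `y ↦ q(−1, y)` has a maximum at `0`
  have hΩ2 : ContDiff ℝ 2 (curl (W (-1))) :=
    contDiff_curl (n := 2) (analyticOnNhd_slice hcont (bdd_of_hasTypeITimeDecay hrate) hmild (by norm_num)).contDiff
  have hq2 : ContDiff ℝ 2 (q (-1)) := hΩ2.inner ℝ hΩ2
  have hxmax : IsLocalMax (q (-1)) 0 := by
    refine Eventually.of_forall fun y => ?_
    have h1 := hle (-1) (by norm_num) y
    simp only [hqdef] at h1 ⊢
    rw [hmax]; simpa using h1
  have hD0 : fderiv ℝ (q (-1)) 0 = 0 := IsLocalMax.fderiv_eq_zero hxmax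
  have hL0 : (Δ (q (-1))) 0 ≤ 0 := IsLocalMax.laplacian_nonpos hq2 hxmax
  -- the weighted slice `y ↦ (−1)² q(−1, y)` is the slice `q(−1, ·)`
  have hslice : (fun y => (-1 : ℝ) ^ 2 * ⟪curl (W (-1)) y, curl (W (-1)) y⟫_ℝ) = q (-1) := by
    funext y; simp [hqdef]
  rw [hderiv0, hslice, hD0] at hid
  simp only [zero_apply, add_zero, zero_sub] at hid
  refine ⟨hD0, hL0, ?_⟩
  -- `−Δq(−1,0) = −2 q + (2P − 2F)` and `Δq ≤ 0`
  simp only [hqdef] at hL0 hid ⊢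
  nlinarith [hid, hL0]

/-! ### The poloidal normal form -/

/-- **POLOIDAL ENSTROPHY HOT-SPOT NORMAL FORM (for the residue S2′).**  If some profile of the route's Type-I class,
poloidal along `e₃` with the frozen constraint on every slice, is not irrotational, then there is a poloidal frozen
`W ∈ 𝔓(C)` (same constant) and `M > 0` with `(−t)²|curl W(t,x)|² ≤ M` everywhere, `|curl W(−1,0)|² = M`,
`D|ω|²(−1,·)(0) = 0`, `Δ|ω|²(−1,·)(0) ≤ 0` and `⟪ω, DW ω⟫(−1,0) ≥ M + |∇ω(−1,0)|²_F`. -/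
theorem exists_poloidal_enstrophy_hotSpot {v : ℝ → EuclideanSpace ℝ (Fin 3) → EuclideanSpace ℝ (Fin 3)}
    (hrate : HasTypeITimeDecay C v)
    (hcont : ContinuousOn (uncurry v) (Iio (0 : ℝ) ×ˢ univ))
    (hmild : ∀ s t : ℝ, s < t → t < 0 → ∀ x,
      v t x = UnboundedOperators.heatExtension (v s) (t - s) x - oseenDuhamel 1 s v v t x)
    (hdiv : ∀ t < 0, VectorCalculus.IsDivFree (v t))
    (hpol : ∀ s < 0, ∀ y, ⟪curl (v s) y, EuclideanSpace.single 2 (1 : ℝ)⟫_ℝ = 0)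
    (hfro : ∀ s < 0, ∀ y, ⟪fderiv ℝ (v s) y (curl (v s) y), EuclideanSpace.single 2 (1 : ℝ)⟫_ℝ = 0)
    {s₀ : ℝ} (hs₀ : s₀ < 0) {y₀ : EuclideanSpace ℝ (Fin 3)} (hne : curl (v s₀) y₀ ≠ 0) :
    ∃ (W : ℝ → EuclideanSpace ℝ (Fin 3) → EuclideanSpace ℝ (Fin 3)) (M : ℝ),
      IsTypeIAncientMild C W ∧
      (∀ s < 0, ∀ y, ⟪curl (W s) y, EuclideanSpace.single 2 (1 : ℝ)⟫_ℝ = 0) ∧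
      (∀ s < 0, ∀ y, ⟪fderiv ℝ (W s) y (curl (W s) y), EuclideanSpace.single 2 (1 : ℝ)⟫_ℝ = 0) ∧
      0 < M ∧
      (∀ t < 0, ∀ x, (-t) ^ 2 * ⟪curl (W t) x, curl (W t) x⟫_ℝ ≤ M) ∧
      ⟪curl (W (-1)) 0, curl (W (-1)) 0⟫_ℝ = M ∧
      fderiv ℝ (fun y => ⟪curl (W (-1)) y, curl (W (-1)) y⟫_ℝ) 0 = 0 ∧
      (Δ (fun y => ⟪curl (W (-1)) y, curl (W (-1)) y⟫_ℝ)) 0 ≤ 0 ∧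
      M + frobeniusNormSq (fderiv ℝ (curl (W (-1))) 0) ≤
        ⟪curl (W (-1)) 0, fderiv ℝ (W (-1)) 0 (curl (W (-1)) 0)⟫_ℝ := by
  have hv : IsTypeIAncientMild C v := isTypeIAncientMild_of_class hrate hcont hmild hdiv
  -- the property «poloidal + frozen» is preserved by the symmetries and the KNSS limits
  obtain ⟨W, M, hW, ⟨hWpol, hWfro⟩, hMpos, hle, hmax⟩ := exists_enstrophy_hotSpot
    (P := fun u => (∀ s < 0, ∀ y, ⟪curl (u s) y, EuclideanSpace.single 2 (1 : ℝ)⟫_ℝ = 0) ∧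
      (∀ s < 0, ∀ y, ⟪fderiv ℝ (u s) y (curl (u s) y), EuclideanSpace.single 2 (1 : ℝ)⟫_ℝ = 0))
    (fun u x₀ hu => ⟨poloidal_translate hu.1 x₀, frozen_translate hu.2 x₀⟩)
    (fun u c hc hu => ⟨poloidal_nsRescale hu.1 hc, frozen_nsRescale hu.2 hc⟩)
    (fun w W' _ hw _ _ hgrad => ⟨fun s hs y => poloidal_of_tendsto (hgrad s hs y) fun j => (hw j).1 s hs y,
      fun s hs y => frozen_of_tendsto (hgrad s hs y) fun j => (hw j).2 s hs y⟩)
    hv ⟨hpol, hfro⟩ hs₀ hne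
  obtain ⟨hD, hL, hP⟩ := enstrophyHotSpot_firstOrder hW hle hmax
  refine ⟨W, M, hW, hWpol, hWfro, hMpos, hle, hmax, hD, hL, ?_⟩
  rw [hmax] at hP
  exact hP

end Summit.NavierStokesRegularity.NavierStokesRegularity.Theorems.PoloidalWindowDoorPoloidalWindowRigidityEnstrophyHotSpotFirstOrder

end
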